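import Summits.Ventures.YMGap.YM3IR.CovariantFamily
import Summits.QuantumFields.Balaban3D.Proofs.ScalesArithmetic
import HarnessLib

/-!
# YM₃ infrared statement — `YM3IR/TerminalFormat.lean`: what Bałaban's Theorems 1–2 deliver AT THE TERMINAL SCALE of each
family member, BY NAME, and the ε-, volume-uniform delivery lemma (cell `pub-ymgap`, track Y4; ym3ir-theory-1, gen 6 —
the UV half of the lead's commission R2; scope = ruling R205 NARROW GO: items (1)+(2) only)

HONEST FRAMING. WHAT THIS IS: a venture file of TYPES and bookkeeping on top of the tree's as-printed typing of
T. Bałaban, CMP 102 (1985) (`Balaban1985CMP102.Theorems`, cell pub-balaban3d), the Bałaban₃ lane's scale arithmetic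
(`Balaban3D.Proofs.ScalesArithmetic`, `Constants.eps0Of`) and theory-1/theory-2's Y4 files (`UVInterface`, `CarrierFamily`,
`BalabanCofinal`, `CovariantFamily`). It proves NOTHING about Yang–Mills: lattice statements and typing only, no continuum
limit, no Clay claim; no axiom, no `sorry`, `0` compute. Nothing of theory-2's `Statement.lean` (frozen v2) is touched; the
§Y4 sentence of record (`massGap3Cofinal_su2_balaban_of_irConjecture3`), its covariant/tier-2 form
(`massGap3Cofinal_su2_W_of_irConjecture3Cov`) and the ONE conjecture of record `IRConjecture3Cov` stand. NO new conjecture is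
declared here: the re-typing of clause (a) as an implication FROM the terminal output (`IRConjecture3UV`, with the `SU(2)`
tier-2 sentence consuming `BalabanUV3At`) is STAGED ONLY in the cell (`HOME/ym3ir/lean/TerminalFormat-theory1.lean`) and held
until the Sunday item-(15) ruling per R196/R200/R201/R205.

WHAT IT SAYS.
(§1) `BalabanUV3At mk 𝔊 eps0` — Bałaban's Theorem 1 (compact-window reading, `B10.Thm1PrintedCompact`) AND Theorem 2
(`SectD.Thm2AsPrinted` = `B10.Thm2Printed`) BY NAME for ONE group as printed `𝔊` on the run family AT ONE terminal-spacing
function `eps0` — LITERALLY the per-group conjunct the Bałaban₃ lane's end theorem delivers at its exhibited `eps0 = eps0Of γ₀`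
(`Balaban3D.Proofs.EndTheorem.uvStability3D_not_literal`, first conjunct; `B10Assembly.thm1Compact_and_thm2_of_leafSystem`) —
and `balabanUV3_of_forall_exists_at`: this joint form at some positive `ε₀(g)` for every group implies the hypothesis OF
RECORD `BalabanUV3 mk` (which keeps one `∃ ε₀` per theorem).
(§2) The terminal coupling, re-derived bookkeeping over `Setting.Scales` (the identity `g_K = g·ε₀^{1/2}` is the lane's
`ScalesArithmetic.gk_K_eq`, used BY NAME): `g_K = (γ₀²)^{1/2}` with `γ₀² = g²ε₀` (`gk_terminal_eq_sqrt_gammaSq`); on the family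
`g_K = g·(eps0 g)^{1/2}` depends on `g` alone (`gk_terminal_eq_of_family`); it is the constant `γ^{1/2}` under print's reading
`ε₀(g) = γ/g²` (`gk_terminal_eq_sqrt_of_eps0`) and the constant `min γ₀ 1` at the lane's EXHIBITED `ε₀(g) = (min γ₀ 1)²/g²`
(`gk_terminal_eq_of_eps0Of`).
(§3) `TerminalFormatAt mk 𝔊 S O1` — what print gives member `S` AT ITS LAST STEP `K`, BY NAME and nothing re-typed: display (5)
at `k = K`, `B10.Bounds5At (mk G 𝔊 S).toRunData O1 S.K` — unfolded (`RunObjects.bounds5At_toRunData_iff`):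
«χ_K(U)·exp[−(1/g_K²) A^η(U_K(U)) − O1·|T₁^{(K)}|] ≤ ρ_K(U) ≤ exp(O1·|T₁^{(K)}|)» for every configuration `U`, i.e. a two-sided
control of the UNIT-LATTICE density `ρ_K` (below: on the small-field set `χ_K`) by the background minimal action at the
effective Wilson coupling `1/g_K² = 1/γ₀² = β_W,eff` — AND Theorem 2's slot `(mk G 𝔊 S).ineq41_47 S.K` («ρ_K satisfies (41),
(47)»: the small-field analytic representation and the large-field bound; ABSTRACT at the level of `RunObjects`).
`UVTerminalOutput mk 𝔊 eps0` — for every compact window of terminal couplings ONE `O1` serves every member of `Family L eps0`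
(every `g`, every `ε = ε₀L^{−K}`, every volume) whose `g_K` lies in the window: THIS is the input type the infrared theorem
must accept from the UV side. PROVED bookkeeping: `BalabanUV3At mk 𝔊 eps0 → UVTerminalOutput mk 𝔊 eps0`
(`uvTerminalOutput_of_balabanUV3At`: `k := K` in Theorem 1's window clause, Theorem 2 at `K`); per coupling `g` ONE `O1`
(`terminalFormat_uniform_per_g` — display (3)'s «constant O(1) depending on g and ε₀ only»); under `ε₀(g) = γ/g²`, and in
particular at the lane's `eps0Of γ₀`, ONE `O1` for the ENTIRE family (`terminalFormat_uniform_of_eps0`,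
`terminalFormat_uniform_of_eps0Of`); and, from the hypothesis OF RECORD `BalabanUV3 mk`, each theorem's terminal statement at
ITS OWN `ε₀` (`exists_eps0_bounds5Terminal_of_balabanUV3`, `exists_eps0_thm2Terminal_of_balabanUV3` — the two `ε₀` need not
coincide under `BalabanUV3` as typed; they do in the joint form).

HONEST LABEL (R196 wording, unchanged by this file). The §Y4 arrow of record is `BalabanUV3 ∧ ClusterDomainClustering ∧
IRConjecture3Cov ⟹ MassGap3Cofinal` with `IRConjecture3Cov` a genuine SUFFICIENT CONDITION (it implies the target; the target is
NOT KNOWN to imply it), never «the remaining gap», and with `BalabanUV3` idle in the kernel arrow (theory-2's F2) until clause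
(a) is threaded from the terminal output — which this file PREPARES (the antecedent type and its delivery from print) and does
NOT perform. What the typing buys, when threaded: whoever attacks the crossover receives, as hypotheses and ε-, volume-uniformly,
the two-sided bound (5)_K on the unit-lattice density at `β_W,eff = 1/γ₀²` and Theorem 2's representation (41)/(47)_K — the
honest starting point of the `M' = ⌈log_L(1/(N γ₀² β⋆))⌉` further covariant averaging steps clause (a) asks for
(`CarrierBridge.betaTree_div_pow_le_iff`; `SU(2)`, `β⋆ = 1/16`: `L^{M'} ≥ 8/γ₀²`). NOT claimed: that (5)/(41)/(47) as typed
(inequalities, Theorem 2's slot abstract at the level of `RunObjects`) suffice to RUN those steps — the identity-level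
small-field formula behind (41) is [7]'s and is not a printed statement (`UVInterface` N1, `TerminalAdapter`). CARRIER NOTE:
`TerminalFormatAt` speaks of `ρ_K` on BAŁABAN's carrier (`(mk G 𝔊 S).rho`, unit lattice `T₁^{(K)}`); its transport to
theory-2's `coarseFamily ρ β W M` is `CarrierBridge.integral_coarseLaw` / `integral_coarseFamily_of_factors` under the OWED
construction `CarrierBridge.FactorsThroughAveraging` (flag (ii), not claimed here).

WHY THIS IS NOVEL (one sentence). It is the first typing in this tree of the exact object the ultraviolet renormalisation-group
programme hands to ANY infrared argument in d = 3 — the terminal unit-lattice density with its printed two-sided bounds and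
representation, indexed by the SAME group, terminal spacing `ε₀(g)` and family member as the infrared coupling set, with the
ε- and volume-uniformity of its constant proved and its specialisation to the Bałaban₃ lane's exhibited `ε₀(g)` requiring no
adaptation — so that the UV theorems can be CONSUMED by the kernel arrow rather than carried as an idle conjunct.

## References
* T. Bałaban, Ultraviolet stability of three-dimensional lattice pure gauge field theories, CMP 102 (1985) 255:
  (1)–(6) p.256, Thm 1 p.257, (41) p.266, (47) p.268, Thm 2 p.272. [cite: Balaban1985UV3]
* Cell files: ym3ir/YM3-IR-theory1.md §15–§16, ym3ir/YM3-IR.md §C, theory-2's ym3ir/AUDIT-theory2-g4.md (F2), HANDOFF-lead.md §Y4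
  (R2), ruling R205 (INBOX 2026-08-23T02:27Z).
-/

noncomputable section

open MeasureTheory
open Literature.MathematicalPhysics.QuantumLattice Literature.MathematicalPhysics.QuantumFieldTheory
open Balaban1985CMP102 Balaban1985CMP102.Setting Balaban1985CMP102.Theorems
open Literature.MathematicalPhysics.QuantumFieldTheory.Balaban1983to89 (GaugeGroup HaarData)
open Summit.QuantumFields.Balaban3D.Carriers (suGroupModel)
open Summit.QuantumFields.Balaban3D.Proofs

namespace Summit.Ventures.YMGap.YM3IR

open CarrierBridge

/-! ## §1  Bałaban's two theorems AT one terminal spacing (member-level, joint `ε₀`) -/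

section AtEps0

variable {L : ℕ} {G : Type} [GaugeGroup G] [MeasurableSpace G] [HaarData G]

/-- **`BalabanUV3At mk 𝔊 eps0` — Theorems 1 and 2 of CMP 102 for the group as printed `𝔊` AT the terminal-spacing
function `eps0` (typed, not asserted).** The 4D cell's `B10.Thm1PrintedCompact` (Thm 1 p. 257 in the compact-coupling-window
reading, the one certified from the printed leaves) and `SectD.Thm2AsPrinted` (Thm 2 p. 272: (41), (47) for `k ≤ K`) BY NAME
on the run family `runs mk G 𝔊 eps0` — both on the SAME family, as print has it (Thm 2 speaks of «the sequence of densities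
ρ_k defined by the inductive equations (2), with ρ₀ given by (1)», the sequence of Thm 1) and as the lane's assembly
`B10Assembly.thm1Compact_and_thm2_of_leafSystem` delivers. [cite: Balaban1985UV3, Thm 1 p.257; Thm 2 p.272] -/
def BalabanUV3At (mk : Construction L) (𝔊 : GroupModel G) (eps0 : ℝ → ℝ) : Prop :=
  Balaban1983to89.B10.Thm1PrintedCompact (runs mk G 𝔊 eps0) ∧ SectD.Thm2AsPrinted (runs mk G 𝔊 eps0)

end AtEps0

/-- The joint form at SOME positive `ε₀(g)` for every group as printed implies the hypothesis of record `BalabanUV3 mk`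
(which keeps one `∃ ε₀` per theorem). Bookkeeping about the cell's typing, no content of the paper.
[cite: Balaban1985UV3, p.256 L15–18; Thm 1 p.257; Thm 2 p.272] -/
theorem balabanUV3_of_forall_exists_at {L : ℕ} {mk : Construction L}
    (h : ∀ (G : Type) [GaugeGroup G] [MeasurableSpace G] [HaarData G] (𝔊 : GroupModel G),
      ∃ eps0 : ℝ → ℝ, (∀ g : ℝ, 0 < g → 0 < eps0 g) ∧ BalabanUV3At mk 𝔊 eps0) :
    BalabanUV3 mk := by
  refine ⟨fun G _ _ _ 𝔊 => ?_, fun G _ _ _ 𝔊 => ?_⟩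
  · obtain ⟨eps0, hpos, hAt⟩ := h G 𝔊
    exact ⟨eps0, hpos, hAt.1⟩
  · obtain ⟨eps0, hpos, hAt⟩ := h G 𝔊
    exact ⟨eps0, hpos, hAt.2⟩

/-! ## §2  The terminal coupling `g_K` (re-derived bookkeeping over `Setting.Scales`; `g_K = g·ε₀^{1/2}` itself is the
Bałaban₃ lane's `ScalesArithmetic.gk_K_eq`, used BY NAME) -/

namespace Dictionary

variable {L : ℕ}

/-- `g_K = (γ₀²)^{1/2}` with `γ₀² = g²ε₀` the terminal coupling of the dictionary (`Dictionary.gammaSq`; `g_K = g·ε₀^{1/2}` is the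
lane's `ScalesArithmetic.gk_K_eq`). [cite: Balaban1985UV3, (5) p.256] -/
theorem gk_terminal_eq_sqrt_gammaSq (S : Scales L) : S.gk S.K = Real.sqrt (gammaSq S) := by
  rw [ScalesArithmetic.gk_K_eq]
  unfold gammaSq
  rw [Real.sqrt_mul (sq_nonneg _), Real.sqrt_sq S.g_pos.le]

/-- On the family at `eps0`, `g_K = g·(eps0 g)^{1/2}` — a function of the coupling `g` alone (all `ε`, all volumes).
[cite: Balaban1985UV3, p.256 L15–18] -/
theorem gk_terminal_eq_of_family {eps0 : ℝ → ℝ} (S : Family L eps0) :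
    S.1.gk S.1.K = S.1.g * Real.sqrt (eps0 S.1.g) := by
  rw [ScalesArithmetic.gk_K_eq, S.2]

/-- Under print's «ε₀ depending on g only» read as ONE terminal coupling, `ε₀(g) = γ/g²` (`CarrierBridge.gammaSq_eq_of_eps0`),
EVERY member of the family has the same terminal coupling `g_K = γ^{1/2}`. [cite: Balaban1985UV3, p.256 L15–18] -/
theorem gk_terminal_eq_sqrt_of_eps0 {eps0 : ℝ → ℝ} {γ : ℝ} (h : ∀ g : ℝ, 0 < g → eps0 g = γ / g ^ 2)
    (S : Family L eps0) : S.1.gk S.1.K = Real.sqrt γ := by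
  rw [gk_terminal_eq_sqrt_gammaSq, gammaSq_eq_of_eps0 h S]

/-- At the Bałaban₃ lane's EXHIBITED terminal spacing `ε₀(g) = (min γ₀ 1)²/g²` (`Balaban3D.Proofs.Constants.eps0Of`, ruling R-EPS0′;
the `eps0` of its end theorem `EndTheorem.uvStability3D`) every member has `g_K = min γ₀ 1` — the lane's
`ScalesArithmetic.gK_eq_of_eps0Of` on the family subtype. [cite: Balaban1985UV3, (2) + (5) p.256] -/
theorem gk_terminal_eq_of_eps0Of {γ₀ : ℝ} (hγ : 0 ≤ γ₀) (S : Family L (Constants.eps0Of γ₀)) :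
    S.1.gk S.1.K = min γ₀ 1 :=
  ScalesArithmetic.gK_eq_of_eps0Of S.1 hγ S.2

end Dictionary

/-! ## §3  The terminal format of a member and the UV side's terminal output on the family -/

section Terminal

variable {L : ℕ} {G : Type} [GaugeGroup G] [MeasurableSpace G] [HaarData G]

/-- **`TerminalFormatAt mk 𝔊 S O1` — what Theorems 1–2 give family member `S` AT ITS LAST STEP `K`, BY NAME.**
(i) Display (5) at `k = K` with constant `O1`: `B10.Bounds5At (mk G 𝔊 S).toRunData O1 S.K`, i.e.
(`RunObjects.bounds5At_toRunData_iff`) for every `U`,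
`χ_K(U)·exp[−(1/g_K²)·A^η(U_K(U)) − O1·|T₁^{(K)}|] ≤ ρ_K(U) ≤ exp(O1·|T₁^{(K)}|)` — the density `ρ_K` on the UNIT lattice
`T₁^{(K)}` is controlled two-sidedly (below on the small-field set `χ_K`) by the background minimal action at the effective
coupling `1/g_K² = 1/γ₀²`; (ii) Theorem 2's slot at `K`: `(mk G 𝔊 S).ineq41_47 S.K` («ρ_K satisfies (41), (47)» — the
small-field analytic representation (41) p. 266 and the large-field bound (47) p. 268; ABSTRACT at the level of
`RunObjects`, pinned to the typed displays only inside the 4D cell's tower). Nothing of (5)/(41)/(47) is re-typed here.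
[cite: Balaban1985UV3, (5) p.256; (41) p.266; (47) p.268] -/
def TerminalFormatAt (mk : Construction L) (𝔊 : GroupModel G) (S : Scales L) (O1 : ℝ) : Prop :=
  Balaban1983to89.B10.Bounds5At (mk G 𝔊 S).toRunData O1 S.K ∧ (mk G 𝔊 S).ineq41_47 S.K

/-- **`UVTerminalOutput mk 𝔊 eps0` — the UV side's delivery at the terminal scale, on the family at `eps0`:** for every
compact window `[gmin, gmax] ⊂ (0, ∞)` of TERMINAL couplings ONE constant `O1` such that every member `S` of `Family L eps0`
(every coupling `g`, spacing `ε = ε₀L^{−K}`, volume) with `g_K ∈ [gmin, gmax]` has the terminal format with that `O1`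
(p. 257 L1 «the constant O(1) is independent of ε, k, g_k in a bounded set», at `k = K`).  This is the input type the
infrared theorem must accept from the UV side (the antecedent of clause (a) once threaded). [cite: Balaban1985UV3, Thm 1 p.257; Thm 2 p.272] -/
def UVTerminalOutput (mk : Construction L) (𝔊 : GroupModel G) (eps0 : ℝ → ℝ) : Prop :=
  ∀ gmin gmax : ℝ, 0 < gmin → gmin ≤ gmax → ∃ O1 : ℝ, ∀ S : Family L eps0,
    gmin ≤ S.1.gk S.1.K → S.1.gk S.1.K ≤ gmax → TerminalFormatAt mk 𝔊 S.1 O1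

/-- **The delivery lemma (PROVED bookkeeping):** Theorems 1–2 at `eps0` give the terminal output — Theorem 1's window
clause at `k := K ≤ K`, Theorem 2's slot at `K`. [cite: Balaban1985UV3, Thm 1 p.257; Thm 2 p.272] -/
theorem uvTerminalOutput_of_balabanUV3At {mk : Construction L} {𝔊 : GroupModel G} {eps0 : ℝ → ℝ}
    (h : BalabanUV3At mk 𝔊 eps0) : UVTerminalOutput mk 𝔊 eps0 := by
  intro gmin gmax hmin hle
  obtain ⟨O1, hO⟩ := h.1 gmin gmax hmin hle
  exact ⟨O1, fun S h1 h2 => ⟨hO S S.1.K le_rfl h1 h2, h.2 S S.1.K le_rfl⟩⟩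

/-- **One constant per coupling (PROVED bookkeeping; display (3)'s «constant O(1) depending on g and ε₀ only»):** all
members with coupling `g` share `g_K = g·(eps0 g)^{1/2}`, so ONE `O1` serves them all (all `ε`, all volumes).
[cite: Balaban1985UV3, (3) p.256; Thm 1 p.257] -/
theorem terminalFormat_uniform_per_g {mk : Construction L} {𝔊 : GroupModel G} {eps0 : ℝ → ℝ}
    (hTF : UVTerminalOutput mk 𝔊 eps0) {g : ℝ} (hg : 0 < g) (he : 0 < eps0 g) :
    ∃ O1 : ℝ, ∀ S : Family L eps0, S.1.g = g → TerminalFormatAt mk 𝔊 S.1 O1 := by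
  obtain ⟨O1, hO⟩ := hTF (g * Real.sqrt (eps0 g)) (g * Real.sqrt (eps0 g))
    (mul_pos hg (Real.sqrt_pos.2 he)) le_rfl
  refine ⟨O1, fun S hS => ?_⟩
  have hK : S.1.gk S.1.K = g * Real.sqrt (eps0 g) := by rw [Dictionary.gk_terminal_eq_of_family, hS]
  exact hO S hK.ge hK.le

/-- **One constant for the ENTIRE family under `ε₀(g) = γ/g²` (PROVED bookkeeping):** every member has `g_K = γ^{1/2}`
(`Dictionary.gk_terminal_eq_sqrt_of_eps0`), so the degenerate window `[γ^{1/2}, γ^{1/2}]` serves all of them — the reading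
under which the coupling set is the geometric sequence `{L^K/(Nγ)}` and ONE crossover length `M'` serves the family
(`CarrierBridge.betaTree_div_pow_le_of_eps0`). [cite: Balaban1985UV3, p.256 L15–18; Thm 1 p.257] -/
theorem terminalFormat_uniform_of_eps0 {mk : Construction L} {𝔊 : GroupModel G} {eps0 : ℝ → ℝ} {γ : ℝ}
    (hγ : 0 < γ) (h : ∀ g : ℝ, 0 < g → eps0 g = γ / g ^ 2) (hTF : UVTerminalOutput mk 𝔊 eps0) :
    ∃ O1 : ℝ, ∀ S : Family L eps0, TerminalFormatAt mk 𝔊 S.1 O1 := by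
  obtain ⟨O1, hO⟩ := hTF (Real.sqrt γ) (Real.sqrt γ) (Real.sqrt_pos.2 hγ) le_rfl
  exact ⟨O1, fun S =>
    hO S (Dictionary.gk_terminal_eq_sqrt_of_eps0 h S).ge (Dictionary.gk_terminal_eq_sqrt_of_eps0 h S).le⟩

/-- **One constant for the ENTIRE family at the lane's exhibited `ε₀(g) = (min γ₀ 1)²/g²` (PROVED bookkeeping):** the form
in which the Bałaban₃ lane's end theorem (`EndTheorem.uvStability3D` / `uvStability3D_not_literal`, whose per-group conjunct
`B10.Thm1PrintedCompact ∧ B10.Thm2Printed` on `runs mk G 𝔊 (eps0Of γ₀)` IS `BalabanUV3At mk 𝔊 (eps0Of γ₀)`) plugs in with no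
adaptation: all members sit at `g_K = min γ₀ 1`. [cite: Balaban1985UV3, p.256 L15–18; Thm 1 p.257; Thm 2 p.272] -/
theorem terminalFormat_uniform_of_eps0Of {mk : Construction L} {𝔊 : GroupModel G} {γ₀ : ℝ} (hγ : 0 < γ₀)
    (hTF : UVTerminalOutput mk 𝔊 (Constants.eps0Of γ₀)) :
    ∃ O1 : ℝ, ∀ S : Family L (Constants.eps0Of γ₀), TerminalFormatAt mk 𝔊 S.1 O1 := by
  obtain ⟨O1, hO⟩ := hTF (min γ₀ 1) (min γ₀ 1) (lt_min hγ one_pos) le_rfl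
  exact ⟨O1, fun S =>
    hO S (Dictionary.gk_terminal_eq_of_eps0Of hγ.le S).ge (Dictionary.gk_terminal_eq_of_eps0Of hγ.le S).le⟩

/-- **From the hypothesis OF RECORD, Theorem 1's terminal statement at ITS `ε₀` (PROVED bookkeeping, print's quantifier
order):** `BalabanUV3 mk` gives, for every group as printed, a positive `ε₀(g)` at which (5)_K holds window-uniformly on
the family. [cite: Balaban1985UV3, p.256 L15–18; Thm 1 p.257] -/
theorem exists_eps0_bounds5Terminal_of_balabanUV3 (mk : Construction L) (hUV : BalabanUV3 mk) (𝔊 : GroupModel G) :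
    ∃ eps0 : ℝ → ℝ, (∀ g : ℝ, 0 < g → 0 < eps0 g) ∧
      ∀ gmin gmax : ℝ, 0 < gmin → gmin ≤ gmax → ∃ O1 : ℝ, ∀ S : Family L eps0,
        gmin ≤ S.1.gk S.1.K → S.1.gk S.1.K ≤ gmax →
          Balaban1983to89.B10.Bounds5At (mk G 𝔊 S.1).toRunData O1 S.1.K := by
  obtain ⟨eps0, hpos, h1⟩ := (thm1AsPrintedCompact_iff mk).1 hUV.1 G 𝔊
  refine ⟨eps0, hpos, fun gmin gmax hmin hle => ?_⟩
  obtain ⟨O1, hO⟩ := h1 gmin gmax hmin hle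
  exact ⟨O1, fun S => hO S S.1.K le_rfl⟩

/-- **From the hypothesis OF RECORD, Theorem 2's terminal statement at ITS `ε₀` (PROVED bookkeeping, print's quantifier
order):** `BalabanUV3 mk` gives, for every group as printed, a positive `ε₀(g)` at which every member's `ρ_K` satisfies
(41), (47).  (The two `ε₀` of this and the previous lemma need not coincide under `BalabanUV3` as typed; they do in the joint form
`BalabanUV3At` at one `eps0`.) [cite: Balaban1985UV3, p.256 L15–18; Thm 2 p.272] -/
theorem exists_eps0_thm2Terminal_of_balabanUV3 (mk : Construction L) (hUV : BalabanUV3 mk) (𝔊 : GroupModel G) :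
    ∃ eps0 : ℝ → ℝ, (∀ g : ℝ, 0 < g → 0 < eps0 g) ∧ ∀ S : Family L eps0, (mk G 𝔊 S.1).ineq41_47 S.1.K := by
  obtain ⟨eps0, hpos, h2⟩ := (thm2AsPrintedC_iff mk).1 hUV.2 G 𝔊
  exact ⟨eps0, hpos, fun S => h2 S S.1.K le_rfl⟩

end Terminal

end Summit.Ventures.YMGap.YM3IR
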